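import Summits.Ventures.HSemireg.WedgeApolarSiegelWindow
import Mathlib.Data.Nat.Choose.Lucas
import Mathlib.Data.Nat.Multiplicity

/-!
# Venture HSemireg — WHICH CLASSES ARE SIEGEL FORMS, BY CHARACTERISTIC: none in characteristic `0` or `p > n`; in characteristic `p` the spike `E_j` is a Siegel form
# iff `p ∣ C(n,j)` iff SOME BASE-`p` DIGIT OF `j` EXCEEDS THE CORRESPONDING DIGIT OF `n` (Lucas); for `n = p^e` exactly the inner spikes `E_1, …, E_{n−1}`, so
# `dim(coSiegel_{p^e} ⊓ SI_{p^e}) = p^e − 1`; for `n = p^e − 1` none (every `C(p^e − 1, j)` is a unit mod `p`)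

HONEST FRAMING. Part of the Lean index of the computation cell `pub-hsemireg` (seat p10 gen 20, Sunday typer «UNIFORM-IN-n»).
Finite-dimensional EXTERIOR ALGEBRA + linear algebra + elementary arithmetic of binomial coefficients ONLY: no variety, no cohomology theory, no sheaf, no Ext group,
no semiregularity map; nothing here says that HC / HC_CM / HC_AV holds; no Literature fact is declared or used (Lucas's theorem is Mathlib's `Choose.choose_modEq_prod_range_choose_nat`,
the prime-power case Mathlib's `Nat.Prime.dvd_choose_pow_iff`).  Custodian versions as in `WedgeHankelSiegelIdeal` (1/3) and `WedgeHankelCoSiegel`.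

WHAT IS IN THE TREE.  I19 (`WedgeApolarSiegelWindow`): `w_spike_mem_siegelIdeal_iff` (`E_j ∈ SI_n ⇔ C(n,j) = 0` in `K`), `coSiegel_inf_siegelIdeal_eq_span`,
`finrank_coSiegel_inf_siegelIdeal` (`= #{j ≤ n : C(n,j) = 0 in K}`), `coSiegel_inf_siegelIdeal_eq_bot_iff`, and the single instance `n = p` prime (`E_j`, `0 < j < p`, are Siegel
forms; «count not typed»).  THIS FILE (namespace `Summit.Ventures.HSemireg.Wedge.KernelDuality` continued; imports I19 + two Mathlib arithmetic files) reads those statements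
through the characteristic of `K`:
* §222 **`coSiegel_inf_siegelIdeal_eq_bot_of_charZero`** (characteristic `0`: no class is a Siegel form, every `n`); in characteristic `p`: **`w_spike_mem_siegelIdeal_iff_dvd`**
  (`E_j ∈ SI_n ⇔ p ∣ C(n,j)`), `choose_dvd_factorial'`, `not_prime_dvd_choose_of_lt` (`p > n ⇒ p ∤ C(n,j)`), **`coSiegel_inf_siegelIdeal_eq_bot_of_lt_char`** (`n < p`: none).
* §223 PRIME POWERS `n = p^e`: **`w_spike_mem_siegelIdeal_iff_of_prime_pow`** (`E_j ∈ SI_{p^e} ⇔ j ≠ 0 ∧ j ≠ p^e`),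
  **`finrank_coSiegel_inf_siegelIdeal_prime_pow`: `dim (coSiegel_{p^e} ⊓ SI_{p^e}) = p^e − 1`** (I19 §215's count, for every prime power).
* §224 LUCAS: `prime_dvd_choose_digit_iff` (one digit: `d < p ⇒ (p ∣ C(d,d′) ⇔ d < d′)`), **`prime_dvd_choose_iff_exists_digit_lt`: `p ∣ C(m,k) ⇔ ∃ i, ⌊m/p^i⌋ % p < ⌊k/p^i⌋ % p`**
  (pure arithmetic, every `m k`), hence **`w_spike_mem_siegelIdeal_iff_exists_digit_lt`** (`E_j` is a Siegel form iff some base-`p` digit of `j` exceeds that of `n`) and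
  **`coSiegel_inf_siegelIdeal_eq_bot_iff_digits`** (`coSiegel_n ⊓ SI_n = ⊥ ⇔` every `j ≤ n` is digit-wise `≤ n`).
NOT typed here: the closed count `dim = (n+1) − Π_i (n_i + 1)` over the base-`p` digits `n_i` of `n` (the digit-wise criterion is typed, the product count is not); anything Ext-side.
New names only.
-/

open Module

namespace Summit.Ventures.HSemireg.Wedge.KernelDuality

open Summit.Ventures.HSemireg.Wedge Summit.Ventures.HSemireg.Wedge.Kunneth Summit.Ventures.HSemireg.Wedge.Hankel
  Summit.Ventures.HSemireg.Wedge.BasisFree Summit.Ventures.HSemireg.Wedge.HankelSiegel Summit.Ventures.HSemireg.Wedge.HankelSiegelIdeal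
  Summit.Ventures.HSemireg.Wedge.KunnethKernel Summit.Ventures.HSemireg.Wedge.HankelRankOne Summit.Ventures.HSemireg.Wedge.HankelFrameChange

variable (K : Type*) [Field K] {n : ℕ}

/-! ## §222. Characteristic `0` and characteristic `p > n`: no class is a Siegel form -/

/-- **IN CHARACTERISTIC `0` NO CLASS IS A SIEGEL FORM: `coSiegel_n ⊓ SI_n = ⊥` for every `n`** (every `C(n,j)`, `j ≤ n`, is a non-zero natural number). -/
theorem coSiegel_inf_siegelIdeal_eq_bot_of_charZero [CharZero K] : coSiegel K n n ⊓ siegelIdeal K n n = ⊥ :=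
  (coSiegel_inf_siegelIdeal_eq_bot_iff K).2 fun _ hp => Nat.cast_ne_zero.2 (Nat.choose_pos hp).ne'

/-- **IN CHARACTERISTIC `p`: `E_j ∈ SI_n ⇔ p ∣ C(n,j)`** (`j ≤ n`; I19 `w_spike_mem_siegelIdeal_iff` + `CharP.cast_eq_zero_iff`). -/
theorem w_spike_mem_siegelIdeal_iff_dvd (p : ℕ) [CharP K p] {j : ℕ} (hj : j ≤ n) :
    w K n n (fun i => if i = j then (1 : K) else 0) ∈ siegelIdeal K n n ↔ p ∣ n.choose j := by
  rw [w_spike_mem_siegelIdeal_iff K hj, CharP.cast_eq_zero_iff K p]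

omit [Field K] in
/-- `C(m,k) ∣ m!` for `k ≤ m`. -/
theorem choose_dvd_factorial' {m k : ℕ} (hk : k ≤ m) : m.choose k ∣ m.factorial :=
  Dvd.intro (k.factorial * (m - k).factorial) (by rw [← mul_assoc, Nat.choose_mul_factorial_mul_factorial hk])

omit [Field K] in
/-- a prime `p > m` divides no `C(m,k)`, `k ≤ m` (it does not divide `m!`). -/
theorem not_prime_dvd_choose_of_lt {p m : ℕ} (hp : p.Prime) (hm : m < p) {k : ℕ} (hk : k ≤ m) : ¬ p ∣ m.choose k :=
  fun h => absurd (hp.dvd_factorial.mp (h.trans (choose_dvd_factorial' hk))) (not_le.mpr hm)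

/-- **IN CHARACTERISTIC `p > n` NO CLASS OF DEGREE `n` IS A SIEGEL FORM: `coSiegel_n ⊓ SI_n = ⊥`.** -/
theorem coSiegel_inf_siegelIdeal_eq_bot_of_lt_char (p : ℕ) [CharP K p] (hp : p.Prime) (hn : n < p) : coSiegel K n n ⊓ siegelIdeal K n n = ⊥ :=
  (coSiegel_inf_siegelIdeal_eq_bot_iff K).2 fun _ hj h => not_prime_dvd_choose_of_lt hp hn hj ((CharP.cast_eq_zero_iff K p _).1 h)

/-! ## §223. Prime powers: exactly the inner spikes are Siegel forms -/

/-- **`n = p^e` IN CHARACTERISTIC `p`: `E_j ∈ SI_{p^e} ⇔ j ≠ 0 ∧ j ≠ p^e`** (`j ≤ p^e`; Mathlib `Nat.Prime.dvd_choose_pow_iff`). -/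
theorem w_spike_mem_siegelIdeal_iff_of_prime_pow (p : ℕ) [CharP K p] (hp : p.Prime) {e j : ℕ} (hj : j ≤ p ^ e) :
    w K (p ^ e) (p ^ e) (fun i => if i = j then (1 : K) else 0) ∈ siegelIdeal K (p ^ e) (p ^ e) ↔ j ≠ 0 ∧ j ≠ p ^ e := by
  rw [w_spike_mem_siegelIdeal_iff_dvd K p hj, hp.dvd_choose_pow_iff]

/-- **`dim (coSiegel_{p^e} ⊓ SI_{p^e}) = p^e − 1` IN CHARACTERISTIC `p`** (every prime power; I19's `n = p` instance counted and generalised): the index set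
`{q ≤ p^e : C(p^e, q) = 0 in K}` is `[0, p^e] ∖ {0, p^e}`. -/
theorem finrank_coSiegel_inf_siegelIdeal_prime_pow (p : ℕ) [CharP K p] (hp : p.Prime) (e : ℕ) :
    finrank K ↥(coSiegel K (p ^ e) (p ^ e) ⊓ siegelIdeal K (p ^ e) (p ^ e)) = p ^ e - 1 := by
  classical
  rw [finrank_coSiegel_inf_siegelIdeal, Nat.card_eq_fintype_card, Fintype.card_subtype]
  have hs : (Finset.univ.filter fun q : Fin (p ^ e + 1) => ((p ^ e).choose (q : ℕ) : K) = 0) = Finset.univ \ {0, Fin.last (p ^ e)} := by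
    ext q
    simp only [Finset.mem_filter, Finset.mem_univ, true_and, Finset.mem_sdiff, Finset.mem_insert, Finset.mem_singleton, CharP.cast_eq_zero_iff K p,
      hp.dvd_choose_pow_iff, Fin.ext_iff, Fin.val_zero, Fin.val_last, not_or]
  have h0 : (0 : Fin (p ^ e + 1)) ≠ Fin.last (p ^ e) := by
    intro h
    have h' := congrArg Fin.val h
    rw [Fin.val_zero, Fin.val_last] at h'
    exact (pow_pos hp.pos e).ne h'
  rw [hs, Finset.card_sdiff_of_subset (Finset.subset_univ _), Finset.card_univ, Fintype.card_fin, Finset.card_pair h0]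
  omega

/-! ## §224. Lucas: the Siegel spikes are the digit-wise violators -/

omit [Field K] in
/-- ONE DIGIT: for `d < p` prime, `p ∣ C(d, d′) ⇔ d < d′` (`C(d,d′) ∣ d!` is prime to `p` for `d′ ≤ d`, and `C(d,d′) = 0` for `d < d′`). -/
theorem prime_dvd_choose_digit_iff {p d d' : ℕ} (hp : p.Prime) (hd : d < p) : p ∣ d.choose d' ↔ d < d' := by
  refine ⟨fun h => ?_, fun h => by rw [Nat.choose_eq_zero_of_lt h]; exact dvd_zero p⟩
  by_contra hle
  exact not_prime_dvd_choose_of_lt hp hd (not_lt.mp hle) h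

omit [Field K] in
/-- **LUCAS, DIVISIBILITY FORM: `p ∣ C(m, k) ⇔ ∃ i, ⌊m/p^i⌋ % p < ⌊k/p^i⌋ % p`** — a prime divides a binomial coefficient iff SOME base-`p` digit of `k` exceeds the
corresponding digit of `m` (Mathlib's Lucas congruence `C(m,k) ≡ Π_i C(m_i, k_i) [MOD p]` + the one-digit lemma; every `m`, `k`). -/
theorem prime_dvd_choose_iff_exists_digit_lt {p : ℕ} (hp : p.Prime) (m k : ℕ) : p ∣ m.choose k ↔ ∃ i, m / p ^ i % p < k / p ^ i % p := by
  haveI : Fact p.Prime := ⟨hp⟩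
  -- enough digits for both numbers
  have ha : ∀ {x}, x ≤ m + k → x < p ^ (m + k + 1) := fun {x} hx =>
    lt_of_le_of_lt hx (lt_trans (Nat.lt_succ_self _) (Nat.lt_pow_self hp.one_lt))
  have hm : m < p ^ (m + k + 1) := ha (Nat.le_add_right m k)
  have hk : k < p ^ (m + k + 1) := ha (Nat.le_add_left k m)
  have hL := Choose.choose_modEq_prod_range_choose_nat (p := p) hm hk
  rw [hL.dvd_iff (dvd_refl p), hp.prime.dvd_finsetProd_iff]
  constructor
  · rintro ⟨i, -, hi⟩
    exact ⟨i, (prime_dvd_choose_digit_iff hp (Nat.mod_lt _ hp.pos)).mp hi⟩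
  · rintro ⟨i, hi⟩
    refine ⟨i, Finset.mem_range.mpr ?_, (prime_dvd_choose_digit_iff hp (Nat.mod_lt _ hp.pos)).mpr hi⟩
    -- beyond position `m + k` both digits vanish, so `i ≤ m + k`
    by_contra hi'
    have hle : m + k + 1 ≤ i := not_lt.mp hi'
    have hk0 : k / p ^ i = 0 := Nat.div_eq_of_lt (lt_of_lt_of_le hk (Nat.pow_le_pow_right hp.pos hle))
    rw [hk0, Nat.zero_mod] at hi
    exact Nat.not_lt_zero _ hi

/-- **IN CHARACTERISTIC `p`, `E_j` IS A SIEGEL FORM IFF SOME BASE-`p` DIGIT OF `j` EXCEEDS THE CORRESPONDING DIGIT OF `n`** (`j ≤ n`). -/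
theorem w_spike_mem_siegelIdeal_iff_exists_digit_lt (p : ℕ) [CharP K p] (hp : p.Prime) {j : ℕ} (hj : j ≤ n) :
    w K n n (fun i => if i = j then (1 : K) else 0) ∈ siegelIdeal K n n ↔ ∃ i, n / p ^ i % p < j / p ^ i % p := by
  rw [w_spike_mem_siegelIdeal_iff_dvd K p hj, prime_dvd_choose_iff_exists_digit_lt hp]

/-- **`coSiegel_n ⊓ SI_n = ⊥` IN CHARACTERISTIC `p` IFF EVERY `j ≤ n` IS DIGIT-WISE `≤ n` IN BASE `p`** (equivalently: all base-`p` digits of `n` below the leading one are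
`p − 1`; that reformulation is not typed). -/
theorem coSiegel_inf_siegelIdeal_eq_bot_iff_digits (p : ℕ) [CharP K p] (hp : p.Prime) :
    coSiegel K n n ⊓ siegelIdeal K n n = ⊥ ↔ ∀ j ≤ n, ∀ i, j / p ^ i % p ≤ n / p ^ i % p := by
  rw [coSiegel_inf_siegelIdeal_eq_bot_iff]
  refine forall₂_congr fun j hj => ?_
  rw [Ne, CharP.cast_eq_zero_iff K p, prime_dvd_choose_iff_exists_digit_lt hp, not_exists]
  exact forall_congr' fun i => not_lt

end Summit.Ventures.HSemireg.Wedge.KernelDuality
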